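import Mathlib

/-!
# Gluing local holomorphic extensions of a `π/2`-periodic function — stub `stub_orbitGluing`

Line `boosts-inherit-mirrors` of crux `MirrorModularBoosts.CurvatureBoostCovariance`
(stmt-QuantumFields-9663), Stub 3a of the registered skeleton
`Cruxes/CurvatureBoostCovariance/Lines/boosts_inherit_mirrors.lean` (one of the four proved pieces of
Stub 3, `stub_orbitBandlimit`: the orbit function `θ ↦ 𝔖_N(R_θ · H)` of a doubled test function is a
trigonometric polynomial).  Pure complex analysis over Mathlib; no project vocabulary, no named facts.

Statement (`stub_orbitGluing`).  Let `f : ℝ → ℂ` be `π/2`-periodic and suppose that at EVERY real point `t`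
it is the restriction of a function `Φ_t` holomorphic on a vertical strip `{|Re w - t| < ε_t}` obeying the
exponential-type bound `‖Φ_t w‖ ≤ C_t e^{Nₑ |Im w|}` (the type `Nₑ` uniform in `t`, the constant `C_t` not).
Then `f` is the restriction to `ℝ` of an ENTIRE function `Φ` with `‖Φ w‖ ≤ C e^{Nₑ |Im w|}` on all of `ℂ`.

Proof.  Two local extensions `Φ_{t₁}`, `Φ_{t₂}` agree on the intersection of their strips: the intersection
is convex (hence preconnected) and open, the difference vanishes at the real points near any real point of the
intersection (both equal `f` there), so the identity theorem
(`AnalyticOnNhd.eqOn_zero_of_preconnected_of_frequently_eq_zero`, through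
`OrbitBandlimit.eqOn_zero_of_real_segment`) kills it.  Hence `Φ w := Φ_{Re w} w` is well defined, locally
equal to each `Φ_t`, therefore entire, and equal to `f` on `ℝ`.  It is `π/2`-periodic on `ℂ` because it is so
on `ℝ` (identity theorem again, `OrbitBandlimit.periodic_of_real`).  Finitely many strips cover the compact
period interval `[0, π/2]` (`IsCompact.elim_finite_subcover`), which gives the uniform constant
`C = Σᵢ max(C_{tᵢ}, 0)` on `{0 ≤ Re w ≤ π/2}`, and an integer number of periods (`⌊Re w / (π/2)⌋`,
`OrbitBandlimit.periodic_int`) moves every `w` into that slab without changing `Im w`.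

The `OrbitBandlimit` helpers (strips are open and convex, identity theorem from a real segment, real
periodicity upgrades to complex periodicity) are public: the sibling files of Stub 3 reuse them.

References: standard (identity theorem + compactness); the role of this lemma in the line is Osterwalder–
Schrader, Comm. Math. Phys. 31 (1973) §4 / 42 (1975) §IV–V (Euclidean covariance by analytic continuation
in the rotation angle), where the local continuations come from the boosted OS vectors (Stub 4a).
-/

noncomputable section

-- tree-known workaround (kept in every landed `Negative/*.lean` file):
attribute [-instance] SimplexCategory.instFintypeToTypeOrderHomFinHAddNatLenOfNat

namespace Summit.QuantumFields.YangMills.Theorems.CurvatureBoostCovariance.BoostsInheritMirrors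

open Filter Topology

namespace OrbitBandlimit

/-! ## Complex analysis on vertical strips: identity theorem from a real segment, periodicity -/

/-- The vertical strip `{|Re w - t| < ε}` is open. -/
theorem isOpen_strip (t ε : ℝ) : IsOpen {w : ℂ | |w.re - t| < ε} :=
  isOpen_lt (continuous_abs.comp (Complex.continuous_re.sub continuous_const)) continuous_const

/-- The vertical strip `{|Re w - t| < ε}` is convex. -/
theorem convex_strip (t ε : ℝ) : Convex ℝ {w : ℂ | |w.re - t| < ε} := by
  have hre : IsLinearMap ℝ fun w : ℂ => w.re :=
    ⟨fun u v => Complex.add_re u v, fun c u => Complex.smul_re c u⟩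
  have : {w : ℂ | |w.re - t| < ε} = {w : ℂ | t - ε < w.re} ∩ {w : ℂ | w.re < t + ε} := by
    ext w
    simp only [Set.mem_setOf_eq, Set.mem_inter_iff, abs_lt]
    constructor
    · intro h; constructor <;> linarith [h.1, h.2]
    · intro h; constructor <;> linarith [h.1, h.2]
  rw [this]
  exact (convex_halfSpace_gt hre _).inter (convex_halfSpace_lt hre _)

/-- Real points approaching `t` from the right stay inside the punctured neighbourhood of `t` in `ℂ`. -/
theorem tendsto_ofReal_nhdsGT (t : ℝ) :
    Tendsto (fun s : ℝ => (s : ℂ)) (𝓝[>] t) (𝓝[≠] (t : ℂ)) :=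
  Complex.continuous_ofReal.continuousWithinAt.tendsto_nhdsWithin fun s hs => by
    simp only [Set.mem_compl_iff, Set.mem_singleton_iff, Complex.ofReal_inj]
    exact ne_of_gt hs

/-- **Identity theorem from a real segment.** A function holomorphic on an open preconnected `U ⊆ ℂ`
that vanishes at the real points of a real neighbourhood of `t`, `(t : ℂ) ∈ U`, vanishes on `U`. -/
theorem eqOn_zero_of_real_segment {U : Set ℂ} (hU : IsOpen U) (hUc : IsPreconnected U) {g : ℂ → ℂ}
    (hg : DifferentiableOn ℂ g U) {t : ℝ} (ht : (t : ℂ) ∈ U) (h0 : ∀ᶠ s : ℝ in 𝓝 t, g s = 0) :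
    Set.EqOn g 0 U := by
  have hga : AnalyticOnNhd ℂ g U := hg.analyticOnNhd hU
  have hfreq : ∃ᶠ z in 𝓝[≠] (t : ℂ), g z = 0 :=
    (tendsto_ofReal_nhdsGT t).frequently (h0.filter_mono nhdsWithin_le_nhds).frequently
  exact hga.eqOn_zero_of_preconnected_of_frequently_eq_zero hUc ht hfreq

/-- Two entire functions that agree on `ℝ` agree on `ℂ`. -/
theorem entire_eq_of_eq_on_real {Φ Ψ : ℂ → ℂ} (hΦ : Differentiable ℂ Φ) (hΨ : Differentiable ℂ Ψ)
    (h : ∀ t : ℝ, Φ t = Ψ t) : Φ = Ψ := by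
  have hsub : DifferentiableOn ℂ (fun z => Φ z - Ψ z) Set.univ := (hΦ.sub hΨ).differentiableOn
  have h0 := eqOn_zero_of_real_segment isOpen_univ isPreconnected_univ hsub (t := 0) (Set.mem_univ _)
    (Eventually.of_forall fun s => by simp [h s])
  funext z
  have := h0 (Set.mem_univ z)
  simpa [sub_eq_zero] using this

/-- Periodicity on `ℝ` of an entire function upgrades to periodicity on `ℂ`. -/
theorem periodic_of_real {Φ : ℂ → ℂ} (hΦ : Differentiable ℂ Φ) (c : ℝ)
    (h : ∀ t : ℝ, Φ (t + c) = Φ t) : ∀ z : ℂ, Φ (z + c) = Φ z := by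
  have hΨ : Differentiable ℂ fun z => Φ (z + c) := hΦ.comp (differentiable_id.add_const _)
  have := entire_eq_of_eq_on_real hΨ hΦ fun t => by simpa using h t
  exact fun z => congr_fun this z

/-- Integer iterates of a period. -/
theorem periodic_int {Ψ : ℂ → ℂ} {c : ℂ} (h : ∀ w : ℂ, Ψ (w + c) = Ψ w) (m : ℤ) (w : ℂ) :
    Ψ (w + m * c) = Ψ w := by
  induction m using Int.induction_on generalizing w with
  | zero => simp
  | succ k ih =>
    have h1 : w + ((k : ℤ) + 1 : ℤ) * c = (w + (k : ℤ) * c) + c := by push_cast; ring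
    rw [h1, h, ih]
  | pred k ih =>
    have h1 : w + (-(k : ℤ) - 1 : ℤ) * c + c = w + (-(k : ℤ) : ℤ) * c := by push_cast; ring
    rw [← h (w + (-(k : ℤ) - 1 : ℤ) * c), h1, ih]

/-- **Two local extensions agree on the intersection of their strips** (identity theorem from the common
real segment, on which both restrict to `f`). -/
theorem local_ext_consistent {f : ℝ → ℂ} {ε : ℝ → ℝ} {Φ : ℝ → ℂ → ℂ}
    (hd : ∀ t, DifferentiableOn ℂ (Φ t) {w : ℂ | |w.re - t| < ε t})
    (hf : ∀ t (s : ℝ), |s - t| < ε t → Φ t s = f s)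
    (t₁ t₂ : ℝ) (w : ℂ) (h1 : |w.re - t₁| < ε t₁) (h2 : |w.re - t₂| < ε t₂) : Φ t₁ w = Φ t₂ w := by
  set U : Set ℂ := {w : ℂ | |w.re - t₁| < ε t₁} ∩ {w : ℂ | |w.re - t₂| < ε t₂} with hU
  have hUo : IsOpen U := (isOpen_strip _ _).inter (isOpen_strip _ _)
  have hUc : IsPreconnected U := ((convex_strip _ _).inter (convex_strip _ _)).isPreconnected
  have hsub : DifferentiableOn ℂ (fun z => Φ t₁ z - Φ t₂ z) U :=
    ((hd t₁).mono Set.inter_subset_left).sub ((hd t₂).mono Set.inter_subset_right)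
  have ht : ((w.re : ℝ) : ℂ) ∈ U := by
    simp only [hU, Set.mem_inter_iff, Set.mem_setOf_eq, Complex.ofReal_re]
    exact ⟨h1, h2⟩
  have h0 : ∀ᶠ s : ℝ in 𝓝 w.re, Φ t₁ s - Φ t₂ s = 0 := by
    have h1' : ∀ᶠ s : ℝ in 𝓝 w.re, |s - t₁| < ε t₁ :=
      (isOpen_lt (continuous_abs.comp (continuous_id.sub continuous_const)) continuous_const).mem_nhds h1
    have h2' : ∀ᶠ s : ℝ in 𝓝 w.re, |s - t₂| < ε t₂ :=
      (isOpen_lt (continuous_abs.comp (continuous_id.sub continuous_const)) continuous_const).mem_nhds h2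
    filter_upwards [h1', h2'] with s hs1 hs2
    rw [hf t₁ s hs1, hf t₂ s hs2, sub_self]
  have key := eqOn_zero_of_real_segment hUo hUc hsub ht h0 (show w ∈ U from ⟨h1, h2⟩)
  simpa [sub_eq_zero] using key

/-- **Reduction of a bound modulo the period.**  If `Ψ : ℂ → ℂ` is `π/2`-periodic and bounded by
`C e^{Nₑ|Im w|}` on the slab `{0 ≤ Re w ≤ π/2}`, it is so bounded on `ℂ` (shift by `⌊Re w/(π/2)⌋` periods). -/
theorem bound_of_bound_on_slab {Ψ : ℂ → ℂ} {C Nₑ : ℝ}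
    (hper : ∀ w : ℂ, Ψ (w + (Real.pi / 2 : ℝ)) = Ψ w)
    (hb : ∀ w : ℂ, w.re ∈ Set.Icc (0 : ℝ) (Real.pi / 2) → ‖Ψ w‖ ≤ C * Real.exp (Nₑ * |w.im|)) (w : ℂ) :
    ‖Ψ w‖ ≤ C * Real.exp (Nₑ * |w.im|) := by
  have hpi : 0 < Real.pi / 2 := by positivity
  set m : ℤ := ⌊w.re / (Real.pi / 2)⌋ with hm
  set w₀ : ℂ := w - (m : ℂ) * ((Real.pi / 2 : ℝ) : ℂ) with hw₀
  have hw_eq : w = w₀ + (m : ℂ) * ((Real.pi / 2 : ℝ) : ℂ) := by rw [hw₀]; ring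
  have hΨw : Ψ w = Ψ w₀ := by rw [hw_eq, periodic_int hper m w₀]
  have hre : w₀.re = w.re - m * (Real.pi / 2) := by
    simp [hw₀, Complex.sub_re, Complex.mul_re, Complex.ofReal_re, Complex.ofReal_im]
  have him : w₀.im = w.im := by
    simp [hw₀, Complex.sub_im, Complex.mul_im, Complex.ofReal_re, Complex.ofReal_im]
  have hre0 : w₀.re ∈ Set.Icc (0 : ℝ) (Real.pi / 2) := by
    have h1 : (m : ℝ) ≤ w.re / (Real.pi / 2) := Int.floor_le _
    have h2 : w.re / (Real.pi / 2) < m + 1 := Int.lt_floor_add_one _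
    rw [hre, Set.mem_Icc]
    rw [le_div_iff₀ hpi] at h1
    rw [div_lt_iff₀ hpi] at h2
    constructor <;> nlinarith
  rw [hΨw, ← him]
  exact hb w₀ hre0

end OrbitBandlimit

/-- **Stub 3a — GLUING.**  A `π/2`-periodic function on `ℝ` that near EVERY real point is the restriction of a
function holomorphic on a vertical strip, all of the same exponential type `Nₑ`, is the restriction of an ENTIRE
function of exponential type `Nₑ`: glue by the identity theorem (`local_ext_consistent`), transport periodicity
to `ℂ` (`periodic_of_real`), and get the uniform constant from finitely many strips covering `[0, π/2]`
(`bound_of_bound_on_slab`). -/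
theorem stub_orbitGluing :
    ∀ (f : ℝ → ℂ) (Nₑ : ℝ),
      (∀ t : ℝ, ∃ ε : ℝ, 0 < ε ∧ ∃ (Φ : ℂ → ℂ) (C : ℝ),
        DifferentiableOn ℂ Φ {w : ℂ | |w.re - t| < ε} ∧
        (∀ w : ℂ, |w.re - t| < ε → ‖Φ w‖ ≤ C * Real.exp (Nₑ * |w.im|)) ∧
        ∀ s : ℝ, |s - t| < ε → Φ s = f s) →
      (∀ s : ℝ, f (s + Real.pi / 2) = f s) →
      ∃ (Φ : ℂ → ℂ) (C : ℝ), Differentiable ℂ Φ ∧ (∀ w : ℂ, ‖Φ w‖ ≤ C * Real.exp (Nₑ * |w.im|)) ∧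
        ∀ s : ℝ, Φ s = f s := by
  intro f Nₑ hloc hper
  choose ε hε Φ C hd hg hf using hloc
  -- the glued function
  set Ψ : ℂ → ℂ := fun w => Φ w.re w with hΨ
  have hΨloc : ∀ (t : ℝ) (w : ℂ), |w.re - t| < ε t → Ψ w = Φ t w := fun t w hw =>
    OrbitBandlimit.local_ext_consistent hd hf w.re t w (by simp [hε]) hw
  have hΨd : Differentiable ℂ Ψ := by
    intro w
    have hmem : {z : ℂ | |z.re - w.re| < ε w.re} ∈ 𝓝 w := (OrbitBandlimit.isOpen_strip _ _).mem_nhds (by simp [hε])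
    have heq : Ψ =ᶠ[𝓝 w] Φ w.re := Filter.eventually_of_mem hmem fun z hz => hΨloc w.re z hz
    exact ((hd w.re).differentiableAt hmem).congr_of_eventuallyEq heq
  have hΨf : ∀ s : ℝ, Ψ s = f s := fun s => by
    rw [hΨloc s s (by simp [hε])]
    exact hf s s (by simp [hε])
  -- periodicity on `ℂ`
  have hΨper : ∀ w : ℂ, Ψ (w + (Real.pi / 2 : ℝ)) = Ψ w :=
    OrbitBandlimit.periodic_of_real hΨd _ fun s => by
      have h1 : (s : ℂ) + ((Real.pi / 2 : ℝ) : ℂ) = ((s + Real.pi / 2 : ℝ) : ℂ) := by push_cast; ring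
      rw [h1, hΨf, hΨf, hper]
  -- a uniform constant on `{0 ≤ Re w ≤ π/2}` by compactness
  obtain ⟨T, hT⟩ : ∃ T : Finset ℝ, Set.Icc (0 : ℝ) (Real.pi / 2) ⊆ ⋃ t ∈ T, Set.Ioo (t - ε t) (t + ε t) :=
    isCompact_Icc.elim_finite_subcover (fun t : ℝ => Set.Ioo (t - ε t) (t + ε t)) (fun _ => isOpen_Ioo)
      fun s _ => Set.mem_iUnion.2 ⟨s, by simp [hε]⟩
  set Cmax : ℝ := ∑ t ∈ T, max (C t) 0 with hCmax
  have hCt : ∀ t ∈ T, C t ≤ Cmax := fun t ht =>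
    (le_max_left _ _).trans (Finset.single_le_sum (f := fun s => max (C s) 0) (fun s _ => le_max_right _ _) ht)
  have hbound0 : ∀ w : ℂ, w.re ∈ Set.Icc (0 : ℝ) (Real.pi / 2) → ‖Ψ w‖ ≤ Cmax * Real.exp (Nₑ * |w.im|) := by
    intro w hw
    obtain ⟨t, htT, htw⟩ : ∃ t ∈ T, w.re ∈ Set.Ioo (t - ε t) (t + ε t) := by
      simpa only [Set.mem_iUnion, exists_prop] using hT hw
    have hw' : |w.re - t| < ε t := by
      rw [abs_lt]; constructor <;> linarith [htw.1, htw.2]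
    rw [hΨloc t w hw']
    exact (hg t w hw').trans (mul_le_mul_of_nonneg_right (hCt t htT) (Real.exp_pos _).le)
  exact ⟨Ψ, Cmax, hΨd, OrbitBandlimit.bound_of_bound_on_slab hΨper hbound0, hΨf⟩

end Summit.QuantumFields.YangMills.Theorems.CurvatureBoostCovariance.BoostsInheritMirrors

end
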